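import Mathlib
import Summits.Ventures.HodgeRepro.Tier4.Common.CornerForms

/-!
# Tier4/Common/HeckeOnForms — the Hecke elements of the frozen target acting on the forms of `X_{Γ′}`

Blind re-derivation cell `pub-hodge-repro`, Tier 4 (README §9–§10), seat t4-typer-1 (gen 0).  Target tree path
`lean/Summits/Ventures/HodgeRepro/Tier4/Common/HeckeOnForms.lean`.  Imports `Tier4/Common/CornerForms.lean`
(typer-1: `AutForms` — `pullField`, `grad`, `IsAutForm1`, the action of `Γ` on the ball — and the corner forms).

WHAT IS DEFINED.  The target's Hecke element `h` (`HeckeElement E`: a list of terms `(c, R)`, `R` a complete system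
of right-coset representatives of `Γ′ g Γ′`) acts on a cotangent field `G` on the ball by
`heckeSum d h G z = Σ_terms c • Σ_{r ∈ R} (act r)^* G (z)` — the same shape as the target's `heckeTranslate` on the
Albanese lifts, with the pull-back `pullField (d.act r)` in place of the composite `a ∘ act r` — and
`heckeField d h G = ball.indicator (heckeSum d h G)` (the translate of a form of `X_{Γ′}`, zero outside the ball).

WHAT IS PROVED.  `act_mul`: `act (γ δ) = act γ ∘ act δ` on the ball for unitary `γ, δ`; `jacMat_comp`, `pullField_comp`:
functoriality of the pull-back (chain rule); **`grad_heckeTranslate`**: the gradient of the Hecke translate of a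
function is the Hecke translate of its gradient — so the corner form of the TRANSLATED lift is the `heckeSum` of
the corner form, the identity that makes the bridge's `coeff_pullOmegaS` definitional; `heckeSum_add / smul /
zero`: linearity in the field; **`heckeSum_isAutForm1`**: for `h` of level `Γ′` (`HeckeElement.IsFor`) and `G`
a `1`-form of `X_{Γ′}`, `heckeSum d h G` is again a `1`-form of `X_{Γ′}` — the coset-representative
permutation argument: for `δ ∈ Γ′` each `r δ` lies in exactly one coset `Γ′ r′`, `r ↦ r′` is a bijection of `R`,
and `G` is `Γ′`-invariant.

Nothing here says anything about the status of the Hodge conjecture for CM abelian varieties, which is NOT proved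
(HC_CM is NOT proved by anyone in this repository).
-/

set_option autoImplicit false

noncomputable section

open Matrix MeasureTheory NumberField
open scoped ComplexConjugate ComplexOrder

namespace Summit.Ventures.HodgeRepro.Tier4

/-! ## Unitary matrices and the action -/

section Unitary

variable {E : Type} [Field E] {c : E ≃+* E} {H : Matrix (Fin 3) (Fin 3) E}

/-- `cstar` is anti-multiplicative. -/
theorem cstar_mul (c : E ≃+* E) (A B : Matrix (Fin 3) (Fin 3) E) : cstar c (A * B) = cstar c B * cstar c A := by
  simp only [cstar, Matrix.map_mul, Matrix.transpose_mul]

/-- The product of two `H`-unitary matrices is `H`-unitary. -/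
theorem IsUnitaryOf.mul {g k : Matrix (Fin 3) (Fin 3) E} (hg : IsUnitaryOf c H g) (hk : IsUnitaryOf c H k) :
    IsUnitaryOf c H (g * k) := by
  unfold IsUnitaryOf at *
  rw [cstar_mul]
  calc cstar c k * cstar c g * H * (g * k) = cstar c k * (cstar c g * H * g) * k := by
        simp only [Matrix.mul_assoc]
    _ = H := by rw [hg, hk]

end Unitary

namespace TargetData

variable {F E : Type} [Field F] [NumberField F] [IsGalois ℚ F] [IsCMField F]
  [Field E] [NumberField E] [IsGalois ℚ E] [IsCMField E] (d : TargetData F E)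

/-- The ball matrix of an `H`-unitary matrix lies in `U(2,1)`. -/
theorem toBallMat_mem_U21_of_unitary {γ : Matrix (Fin 3) (Fin 3) E} (hγ : IsUnitaryOf (conjE E) d.H γ) :
    (toBallMat d.τ₀ d.C γ)ᴴ * J * toBallMat d.τ₀ d.C γ = J :=
  toBallMat_J d.τ₀ (conjE E) (complexConj_intertwines E d.τ₀) d.hC hγ

/-- An `H`-unitary matrix preserves the ball. -/
theorem act_mem_ball_of_unitary {γ : Matrix (Fin 3) (Fin 3) E} (hγ : IsUnitaryOf (conjE E) d.H γ)
    {z : Fin 2 → ℂ} (hz : z ∈ ball) : d.act γ z ∈ ball :=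
  actM_mem_ball (d.toBallMat_mem_U21_of_unitary hγ) hz

/-- The action of an `H`-unitary matrix is holomorphic on the ball. -/
theorem differentiableOn_act_of_unitary {γ : Matrix (Fin 3) (Fin 3) E} (hγ : IsUnitaryOf (conjE E) d.H γ) :
    DifferentiableOn ℂ (d.act γ) ball :=
  differentiableOn_actM (d.toBallMat_mem_U21_of_unitary hγ)

/-- The action of an `H`-unitary matrix is differentiable at every point of the ball. -/
theorem differentiableAt_act_of_unitary {γ : Matrix (Fin 3) (Fin 3) E} (hγ : IsUnitaryOf (conjE E) d.H γ)
    {z : Fin 2 → ℂ} (hz : z ∈ ball) : DifferentiableAt ℂ (d.act γ) z :=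
  (d.differentiableOn_act_of_unitary hγ).differentiableAt (isOpen_ball.mem_nhds hz)

/-- **The action is multiplicative on the ball**: `act (γ δ) z = act γ (act δ z)` for `δ` unitary. -/
theorem act_mul {γ δ : Matrix (Fin 3) (Fin 3) E} (hδ : IsUnitaryOf (conjE E) d.H δ) {z : Fin 2 → ℂ}
    (hz : z ∈ ball) : d.act (γ * δ) z = d.act γ (d.act δ z) := by
  unfold act
  rw [toBallMat_mul d.τ₀ d.hC.1, actM_mul (d.toBallMat_mem_U21_of_unitary hδ) hz]

end TargetData

/-! ## Functoriality of the pull-back -/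

/-- **The chain rule for Jacobian matrices**: `jacMat (φ ∘ ψ) z = jacMat φ (ψ z) * jacMat ψ z`. -/
theorem jacMat_comp {φ ψ : (Fin 2 → ℂ) → (Fin 2 → ℂ)} {z : Fin 2 → ℂ} (hφ : DifferentiableAt ℂ φ (ψ z))
    (hψ : DifferentiableAt ℂ ψ z) : jacMat (φ ∘ ψ) z = jacMat φ (ψ z) * jacMat ψ z := by
  ext j k
  simp only [jacMat, Matrix.mul_apply]
  have hφj : DifferentiableAt ℂ (fun w => φ w j) (ψ z) := (differentiableAt_pi.1 hφ) j
  rw [show (fun w => (φ ∘ ψ) w j) = (fun w => φ w j) ∘ ψ from rfl, pd_comp k hφj hψ]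

/-- **Functoriality of the pull-back**: `ψ^*(φ^*G) = (φ ∘ ψ)^*G` at a point. -/
theorem pullField_comp {φ ψ : (Fin 2 → ℂ) → (Fin 2 → ℂ)} (G : (Fin 2 → ℂ) → (Fin 2 → ℂ)) {z : Fin 2 → ℂ}
    (hφ : DifferentiableAt ℂ φ (ψ z)) (hψ : DifferentiableAt ℂ ψ z) :
    pullField ψ (pullField φ G) z = pullField (φ ∘ ψ) G z := by
  simp only [pullField, Function.comp]
  rw [jacMat_comp hφ hψ, Matrix.transpose_mul, ← Matrix.mulVec_mulVec]

/-! ## The Hecke action on cotangent fields -/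

namespace TargetData

variable {F E : Type} [Field F] [NumberField F] [IsGalois ℚ F] [IsCMField F]
  [Field E] [NumberField E] [IsGalois ℚ E] [IsCMField E] (d : TargetData F E)

/-- **The Hecke translate of a cotangent field**: `(T_h G)(z) = Σ_terms c • Σ_{r ∈ R} (act r)^* G (z)`. -/
def heckeSum (h : HeckeElement E) (G : (Fin 2 → ℂ) → (Fin 2 → ℂ)) : (Fin 2 → ℂ) → (Fin 2 → ℂ) :=
  fun z => (h.terms.map fun t => t.1 • (t.2.sum fun r => pullField (d.act r) G z)).sum

/-- The Hecke translate of a single term `(c, R)`. -/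
theorem heckeSum_term (c : ℤ) (R : Finset (Matrix (Fin 3) (Fin 3) E)) (G : (Fin 2 → ℂ) → (Fin 2 → ℂ))
    (z : Fin 2 → ℂ) : d.heckeSum ⟨[(c, R)]⟩ G z = c • R.sum fun r => pullField (d.act r) G z := by
  simp [heckeSum]

/-- Additivity in the field. -/
theorem heckeSum_add (h : HeckeElement E) (G G' : (Fin 2 → ℂ) → (Fin 2 → ℂ)) :
    d.heckeSum h (G + G') = d.heckeSum h G + d.heckeSum h G' := by
  funext z
  simp only [heckeSum, pullField_add, Pi.add_apply, Finset.sum_add_distrib, smul_add]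
  rw [← List.sum_map_add]

/-- Homogeneity in the field. -/
theorem heckeSum_smul (h : HeckeElement E) (a : ℂ) (G : (Fin 2 → ℂ) → (Fin 2 → ℂ)) :
    d.heckeSum h (a • G) = a • d.heckeSum h G := by
  funext z
  simp only [heckeSum, pullField_smul, Pi.smul_apply]
  rw [List.smul_sum, List.map_map]
  congr 1
  refine List.map_congr_left fun t _ => ?_
  simp only [Function.comp, ← Finset.smul_sum]
  rw [smul_comm]

/-- The zero field is fixed. -/
theorem heckeSum_zero (h : HeckeElement E) : d.heckeSum h (0 : (Fin 2 → ℂ) → (Fin 2 → ℂ)) = 0 := by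
  funext z
  simp [heckeSum, pullField_zero]

/-- **The Hecke translate of a form of `X_{Γ′}`**: the Hecke sum on the ball, zero outside it. -/
def heckeField (h : HeckeElement E) (G : (Fin 2 → ℂ) → (Fin 2 → ℂ)) : (Fin 2 → ℂ) → (Fin 2 → ℂ) :=
  ball.indicator (d.heckeSum h G)

/-- On the ball the Hecke translate is the Hecke sum. -/
theorem heckeField_of_mem (h : HeckeElement E) (G : (Fin 2 → ℂ) → (Fin 2 → ℂ)) {z : Fin 2 → ℂ} (hz : z ∈ ball) :
    d.heckeField h G z = d.heckeSum h G z :=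
  Set.indicator_of_mem hz _

/-- Outside the ball the Hecke translate vanishes. -/
theorem heckeField_of_not_mem (h : HeckeElement E) (G : (Fin 2 → ℂ) → (Fin 2 → ℂ)) {z : Fin 2 → ℂ}
    (hz : z ∉ ball) : d.heckeField h G z = 0 :=
  Set.indicator_of_notMem hz _

/-- Additivity of the Hecke translate in the field. -/
theorem heckeField_add (h : HeckeElement E) (G G' : (Fin 2 → ℂ) → (Fin 2 → ℂ)) :
    d.heckeField h (G + G') = d.heckeField h G + d.heckeField h G' := by
  unfold heckeField
  rw [d.heckeSum_add]
  funext z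
  by_cases hz : z ∈ ball <;> simp [hz]

/-- Homogeneity of the Hecke translate in the field. -/
theorem heckeField_smul (h : HeckeElement E) (a : ℂ) (G : (Fin 2 → ℂ) → (Fin 2 → ℂ)) :
    d.heckeField h (a • G) = a • d.heckeField h G := by
  unfold heckeField
  rw [d.heckeSum_smul]
  funext z
  by_cases hz : z ∈ ball <;> simp [hz]

/-- The Hecke translate of the zero field is zero. -/
theorem heckeField_zero (h : HeckeElement E) : d.heckeField h (0 : (Fin 2 → ℂ) → (Fin 2 → ℂ)) = 0 := by
  unfold heckeField
  rw [d.heckeSum_zero]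
  funext z
  by_cases hz : z ∈ ball <;> simp [hz]

/-- Every representative of a term of a Hecke element of level `Γ′` is `H`-unitary (`r = γ₁ g γ₂`). -/
theorem isUnitaryOf_of_mem_reps {Γ' : Set (Matrix (Fin 3) (Fin 3) E)} (hΓ' : Γ' ⊆ d.Γ) {h : HeckeElement E}
    (hh : h.IsFor (conjE E) d.H Γ') {t : ℤ × Finset (Matrix (Fin 3) (Fin 3) E)} (ht : t ∈ h.terms)
    {r : Matrix (Fin 3) (Fin 3) E} (hr : r ∈ t.2) : IsUnitaryOf (conjE E) d.H r := by
  obtain ⟨g, hg, hreps⟩ := hh t ht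
  obtain ⟨γ₁, hγ₁, γ₂, hγ₂, rfl⟩ := hreps.1 r hr
  exact ((d.isUnitaryOf_of_mem (hΓ' hγ₁)).mul hg).mul (d.isUnitaryOf_of_mem (hΓ' hγ₂))

/-- The gradient of a finite sum of functions differentiable at `z`. -/
theorem grad_finset_sum {ι : Type} (s : Finset ι) (f : ι → (Fin 2 → ℂ) → ℂ) {z : Fin 2 → ℂ}
    (hf : ∀ i ∈ s, DifferentiableAt ℂ (f i) z) : grad (∑ i ∈ s, f i) z = ∑ i ∈ s, grad (f i) z := by
  funext k
  simp only [grad, pd, Finset.sum_apply]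
  rw [fderiv_sum hf]
  simp

/-- The gradient of an integer multiple. -/
theorem grad_zsmul (n : ℤ) (f : (Fin 2 → ℂ) → ℂ) {z : Fin 2 → ℂ} (hf : DifferentiableAt ℂ f z) :
    grad (n • f) z = n • grad f z := by
  funext k
  simp only [grad, pd]
  rw [← Int.cast_smul_eq_zsmul ℂ n f, fderiv_const_smul hf, _root_.smul_apply, Pi.smul_apply,
    Int.cast_smul_eq_zsmul]
  rfl

/-- The gradient of a sum of two functions differentiable at `z`. -/
theorem grad_add (f g : (Fin 2 → ℂ) → ℂ) {z : Fin 2 → ℂ} (hf : DifferentiableAt ℂ f z) (hg : DifferentiableAt ℂ g z) :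
    grad (f + g) z = grad f z + grad g z := by
  funext k
  simp only [grad, pd, Pi.add_apply]
  rw [fderiv_add hf hg]
  rfl

/-- An integer multiple of a differentiable function is differentiable. -/
theorem differentiableAt_zsmul (n : ℤ) {f : (Fin 2 → ℂ) → ℂ} {z : Fin 2 → ℂ} (hf : DifferentiableAt ℂ f z) :
    DifferentiableAt ℂ (n • f) z := by
  rw [← Int.cast_smul_eq_zsmul ℂ]
  exact hf.const_smul _

/-- A function differentiable on the ball composed with the action of a unitary matrix is differentiable at a
point of the ball. -/
theorem differentiableAt_comp_act {u : (Fin 2 → ℂ) → ℂ} (hu : DifferentiableOn ℂ u ball)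
    {γ : Matrix (Fin 3) (Fin 3) E} (hγ : IsUnitaryOf (conjE E) d.H γ) {z : Fin 2 → ℂ} (hz : z ∈ ball) :
    DifferentiableAt ℂ (fun w => u (d.act γ w)) z :=
  (hu.differentiableAt (isOpen_ball.mem_nhds (d.act_mem_ball_of_unitary hγ hz))).comp z
    (d.differentiableAt_act_of_unitary hγ hz)

/-- The Hecke translate of a function, in the form of a sum of a term and the rest. -/
theorem heckeTranslate_cons (t : ℤ × Finset (Matrix (Fin 3) (Fin 3) E)) (ts : List (ℤ × Finset (Matrix (Fin 3) (Fin 3) E)))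
    (u : (Fin 2 → ℂ) → ℂ) :
    heckeTranslate d.τ₀ d.C ⟨t :: ts⟩ u =
      (t.1 • fun z => t.2.sum fun r => u (d.act r z)) + heckeTranslate d.τ₀ d.C ⟨ts⟩ u := by
  funext z
  simp [heckeTranslate, act]

/-- The Hecke translate of a cotangent field, in the form of a sum of a term and the rest. -/
theorem heckeSum_cons (t : ℤ × Finset (Matrix (Fin 3) (Fin 3) E)) (ts : List (ℤ × Finset (Matrix (Fin 3) (Fin 3) E)))
    (G : (Fin 2 → ℂ) → (Fin 2 → ℂ)) (z : Fin 2 → ℂ) :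
    d.heckeSum ⟨t :: ts⟩ G z = t.1 • (t.2.sum fun r => pullField (d.act r) G z) + d.heckeSum ⟨ts⟩ G z := by
  simp [heckeSum]

/-- The Hecke translate of a function is differentiable at every point of the ball (all representatives unitary). -/
theorem differentiableAt_heckeTranslate {u : (Fin 2 → ℂ) → ℂ} (hu : DifferentiableOn ℂ u ball)
    (ts : List (ℤ × Finset (Matrix (Fin 3) (Fin 3) E)))
    (hts : ∀ t ∈ ts, ∀ r ∈ t.2, IsUnitaryOf (conjE E) d.H r) {z : Fin 2 → ℂ} (hz : z ∈ ball) :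
    DifferentiableAt ℂ (heckeTranslate d.τ₀ d.C ⟨ts⟩ u) z := by
  induction ts with
  | nil =>
    have h0 : heckeTranslate d.τ₀ d.C ⟨[]⟩ u = fun _ => 0 := by
      funext w
      simp [heckeTranslate]
    rw [h0]
    exact differentiableAt_const _
  | cons t ts ih =>
    rw [d.heckeTranslate_cons]
    have h1 : DifferentiableAt ℂ (fun z => t.2.sum fun r => u (d.act r z)) z := by
      have : (fun z => t.2.sum fun r => u (d.act r z)) = ∑ r ∈ t.2, fun z => u (d.act r z) := by
        funext z; simp
      rw [this]
      exact DifferentiableAt.sum fun r hr => d.differentiableAt_comp_act hu (hts t (List.mem_cons_self) r hr) hz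
    have h2 := ih fun t' ht' => hts t' (List.mem_cons_of_mem _ ht')
    exact (differentiableAt_zsmul _ h1).add h2

/-- **The gradient of a Hecke translate is the Hecke translate of the gradient** (on the ball, all representatives
unitary): `grad (T_h u) z = heckeSum d h (grad u) z`. -/
theorem grad_heckeTranslate {u : (Fin 2 → ℂ) → ℂ} (hu : DifferentiableOn ℂ u ball) (h : HeckeElement E)
    (hh : ∀ t ∈ h.terms, ∀ r ∈ t.2, IsUnitaryOf (conjE E) d.H r) {z : Fin 2 → ℂ} (hz : z ∈ ball) :
    grad (heckeTranslate d.τ₀ d.C h u) z = d.heckeSum h (grad u) z := by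
  obtain ⟨ts⟩ := h
  induction ts with
  | nil =>
    have h0 : heckeTranslate d.τ₀ d.C ⟨[]⟩ u = fun _ => 0 := by
      funext w
      simp [heckeTranslate]
    rw [h0]
    funext k
    simp [heckeSum, grad, pd_const]
  | cons t ts ih =>
    rw [d.heckeTranslate_cons, d.heckeSum_cons]
    have hts : ∀ t' ∈ ts, ∀ r ∈ t'.2, IsUnitaryOf (conjE E) d.H r := fun t' ht' => hh t' (List.mem_cons_of_mem _ ht')
    have hsum : (fun z => t.2.sum fun r => u (d.act r z)) = ∑ r ∈ t.2, fun z => u (d.act r z) := by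
      funext z; simp
    have h1 : DifferentiableAt ℂ (fun z => t.2.sum fun r => u (d.act r z)) z := by
      rw [hsum]
      exact DifferentiableAt.sum fun r hr => d.differentiableAt_comp_act hu (hh t (List.mem_cons_self) r hr) hz
    rw [grad_add _ _ (differentiableAt_zsmul _ h1) (d.differentiableAt_heckeTranslate hu ts hts hz), ih hts,
      grad_zsmul _ _ h1, hsum,
      grad_finset_sum _ _ fun r hr => d.differentiableAt_comp_act hu (hh t (List.mem_cons_self) r hr) hz]
    congr 2
    refine Finset.sum_congr rfl fun r hr => ?_
    have hr' := hh t (List.mem_cons_self) r hr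
    rw [pullField_grad (hu.differentiableAt (isOpen_ball.mem_nhds (d.act_mem_ball_of_unitary hr' hz)))
      (d.differentiableAt_act_of_unitary hr' hz)]
    rfl

end TargetData

end Summit.Ventures.HodgeRepro.Tier4
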